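import Summits.Ventures.PercRepro2.CaseOneStarCertT1
import Summits.Ventures.PercRepro2.CaseOneGadgetUWA1BBlockII0
import Summits.Ventures.PercRepro2.CaseOneGadgetUWA1BBlockII1
import Summits.Ventures.PercRepro2.CaseOneGadgetUWA1BBlockII2
import Summits.Ventures.PercRepro2.CaseOneGadgetUWA1BBlockII3
import Summits.Ventures.PercRepro2.CaseOneGadgetUWA1BBlockII4
import Summits.Ventures.PercRepro2.CaseOneGadgetUWA1BBlockII5
import Summits.Ventures.PercRepro2.CaseOneGadgetUWA1BBlockII6
import Summits.Ventures.PercRepro2.CaseOneGadgetUWA1BBlockII7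
import Summits.Ventures.PercRepro2.CaseOneGadgetUWA1BBlockII8
import Summits.Ventures.PercRepro2.CaseOneGadgetUWA1BBlockII9
import Summits.Ventures.PercRepro2.CaseOneGadgetUWA1BBlockII10
import Summits.Ventures.PercRepro2.CaseOneGadgetUWA1BBlockII11
import Summits.Ventures.PercRepro2.CaseOneGadgetUWA1BBlockII12
import Summits.Ventures.PercRepro2.CaseOneGadgetUWA1BBlockII13
import Summits.Ventures.PercRepro2.CaseOneGadgetUWA1BBlockII14
import Summits.Ventures.PercRepro2.CaseOneStarFactsB

/-!
# The gadget `u ~ {w, a₁, b}`, `w ~ {u, a₂, o}` (uwa1b): the cell certificates of `iiAB5` (part 34c)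
(blind cell PercRepro2, p1 g34; the fourth gadget anchor of the six-form calculus — all six forms of the uwa1b gadget
as plain SFacts-cone certificate chains, generated by mining/p1/g34/uwa1b/genu.py = p1 g33's gent_uwa1.py / g25's
geno.py re-targeted; P1-G33 §6–§6″, P1-G34)

Each `eBABII ijk kl` is a nonnegative combination of `(pairwise atom) × (cell)` and cubic cell monomials — or, for the degree-4 ones, `M × eBABII ijk kl` (`M = Σ cᵢ` the total cell mass) is a nonnegative combination of `(atom) × (cell) × (cell)` and quartic cell monomials, then `SFacts.nonneg_of_sum_mul` (`CaseOneStarCertT1`) — exact LP certificates (kit j318477, every certificate re-verified exactly; data/p1/g33/gcerts_ii_uwa1b.json, form `ii`), here as exact `linear_combination`s over `SFacts` (the rational coefficients cleared by their common denominator). -/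

namespace Summit.Ventures.PercRepro2

namespace CaseOne

section CertABII34c
variable {R : Type*} [Field R] [LinearOrder R] [IsStrictOrderedRing R]

set_option maxHeartbeats 0 in
/-- `eBABII23221 ≥ 0`: the combination is identically zero (`ring`). -/
lemma eBABII23221_nonneg (m : SCells R) (_hf : SFactsB m) : 0 ≤ eBABII23221 m := by
  have h : eBABII23221 m = 0 := by
    unfold eBABII23221 cBABII00121 cBABII00221 cBABII01021 cBABII01121 cBABII01221 cBABII02021 cBABII02121 cBABII02221 cBABII03121 cBABII03221 cBABII10021 cBABII10121 cBABII10221 cBABII11021 cBABII11121 cBABII11221 cBABII12021 cBABII12121 cBABII12221 cBABII13021 cBABII13121 cBABII13221 cBABII20021 cBABII20121 cBABII20221 cBABII21021 cBABII21121 cBABII21221 cBABII22021 cBABII22121 cBABII22221 cBABII23021 cBABII23121 cBABII23221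
    ring
  linarith [h]

set_option maxHeartbeats 0 in
/-- `eBABII23222 ≥ 0`: the combination is identically zero (`ring`). -/
lemma eBABII23222_nonneg (m : SCells R) (_hf : SFactsB m) : 0 ≤ eBABII23222 m := by
  have h : eBABII23222 m = 0 := by
    unfold eBABII23222 cBABII00122 cBABII00222 cBABII01022 cBABII01122 cBABII01222 cBABII02022 cBABII02122 cBABII02222 cBABII03122 cBABII03222 cBABII10022 cBABII10122 cBABII10222 cBABII11022 cBABII11122 cBABII11222 cBABII12022 cBABII12122 cBABII12222 cBABII13022 cBABII13122 cBABII13222 cBABII20022 cBABII20122 cBABII20222 cBABII21022 cBABII21122 cBABII21222 cBABII22022 cBABII22122 cBABII22222 cBABII23022 cBABII23122 cBABII23222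
    ring
  linarith [h]

end CertABII34c

end CaseOne

end Summit.Ventures.PercRepro2
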